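import Summits.QuantumFields.BalabanUV.Beta.FP.PerfectPropagatorLegDataFree
import Summits.QuantumFields.BalabanUV.Beta.FP.PerfectPropagatorKernelGraded

/-!
# `BalabanUV.Beta.FP.PerfectPropagatorLegData` — road «FP» for binder row D1, leaf (H2) of the horizontal route, row **H2-ASM-2** (H2V-DESIGN §4, R-FP-23;
# `LEAVES-FP.md` l.323), PART 2: THE LEG TAYLOR DATA OF THE PERFECT BF PROPAGATOR `P := Re PinfKer` ON `ℤ⁴` — values, first, second and third lattice
# differences with the graded all-`z` letters `(‖z‖∞+1)^{−2,−3,−4,−5}`, and the continuum DICTIONARY `P = c₄|x|⁻² + O(‖z‖∞⁻³)`, `Δ_iP = c₄∂_i|x|⁻² + O(‖z‖∞⁻⁴)`,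
# `Δ_μΔ_νP = c₄∂_μ∂_ν|x|⁻² + O(‖z‖∞⁻⁵)` (the three remainder orders are EXACTLY H2-P-KER (K1)∕(K2)∕(K3)).

HONEST DEPENDENCY (page 1, mandatory): continuum YM on T⁴ ⇐ BetaPertH ∧ nine spine estimates (0/9 proved); BetaPertH ⇐ (D1) ∧ (D4) ∧ CAP+tail;
G-an2-4 gates asym, D1 and NE2/3/4.  HONEST FRAMING (cell contract, verbatim): «discharging `BetaPertH` makes Bałaban's UV stability UNCONDITIONAL —
a real constructive-QFT result; it is NOT the continuum limit and NOT the Clay problem.»  THIS MODULE DISCHARGES NOTHING of the wall: [our object] assembly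
BY NAME of landed letters — gan24-formalise-leaf-05-g35's (C) `PerfectPropagatorKernel` ((K0) `re_PinfKer`, (K1) `norm_KB_le_div_supNorm_cube`) and (D)
`PerfectPropagatorKernelLegs` (`abs_re_PinfKer_le`, `abs_re_PinfKer_fwdDiff_le`, `norm_KB_le_inv_succ_sq`, `supNorm_cast_eq`), THIS lineage's V2b
`PerfectPropagatorKernelGraded` ((K2)∕(K3) all-`z`: `norm_KB_fwdDiff_le_inv_succ_pow_four`, `norm_KB_fwdDiff₂_le_inv_succ_pow_five`) and PARTS 1a∕1b (free
leg at second∕third order over an3-g5's `TwoPowerLegs.free`∕`free_sharp` = lit1's Lawler–Limic kernel theorems).  One [our object] data def (`legP`, the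
name of `z ↦ Re PinfKer α β z`) + five explicit real constants; 0 `def … : Prop`; nothing cited; 0 sorry; constants existential-grade (`CKB`, `CKB₂`, `CKB₃`,
`B3free`, `free.B`∕`free.U`); 0 estimates of Bałaban's CONSTRAINED kernels; 0∕4 row-D1 binders; NEVER «G-an2-4 closed»; NOT `hgerm`, NOT D1, NOT BetaPertH,
NOT continuum, NOT Clay.

ABSOLUTE RULE (cell charter, verbatim): «No internally-minted statement may enter as a cited fact. Every hypothesis is either kernel-proved in this package or a
verbatim quotation of a PUBLISHED theorem with page reference. The manuscript(s) under audit are NOT citable for their own disputed steps — they are the thing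
under adjudication; programme-internal (2001/route/tribunal) claims are never citable.»

WHAT (`z ∈ ℤ⁴ = DyadicShell.Pt`, `s = DyadicShell.supNorm z`, `e_μ = Pi.single μ 1`, `X = toReal z`, `α β : Fin (3+1)`; `legP α β z := (PinfKer α β z).re`):
* §1 [our object] the REMAINDER `Re KB` at second and third order in the `(s+1)` currency: `abs_re_KB_diff2_le` (`≤ 32(CKB₃ 3 + 4·CB0 3)∕(s+1)⁵`, every `μ ν`),
  `abs_re_KB_diff3_le` (`≤ 33·32(CKB₃ 3 + 4·CB0 3)∕(s+1)⁵`).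
* §2 [our object] THE LEG `legP` and ITS LETTERS, every `z`: `legP_eq` ((K0)), **(L0) `abs_legP_le`** (`≤ A0P∕(s+1)²`), **(L1) `abs_legP_diff_le`** (`≤ A1P∕(s+1)³`),
  **(L2) `abs_legP_diff2_le`** (`≤ A2P∕(s+1)⁴`, every `μ ν`), **(L3) `abs_legP_diff3_le`** (`≤ A3P∕(s+1)⁵`, every `κ μ ν`); constants `A0P … A3P` explicit.
* §3 [our object] THE DICTIONARY: **(D0) `abs_legP_sub_invSq_le`** (`z ≠ 0`: `|legP − [α=β]·c₄·|X|⁻²| ≤ D0P∕s³`), **(D1) `abs_legP_diff_sub_d1_le`** (`2 ≤ s`: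
  `|Δ_i legP − [α=β]·c₄·∂_i|X|⁻²| ≤ D1P∕s⁴`), **(D2) `abs_legP_diff2_sub_hess_le`** (`4 ≤ s`: `|Δ_μΔ_ν legP − [α=β]·c₄·∂_μ∂_ν|X|⁻²| ≤ D2P∕s⁵`, every `μ ν`).
* PART 3 `FP/PerfectPropagatorLegDataProducts`: the same letters in Mathlib's `fwdDiff` currency and the two PRODUCT TRANSFERS of H2-ASM-3 (owner GO l.23297).

Provenance: binder row D1 formalisation swarm, lineage beta-d1-formalise-leaf-01, gen 9 (prover-b2b-balaban-beta-d1-formalise-leaf-01-g9-0), 2026-08-20;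
road FP (owner b2b-balaban-beta-d1-p3, H2V-DESIGN f78878bd5f8d2d18), row H2-ASM-2 (first refusal KER lineage, R-FP-23 (c)); INTENT ∕ CLAIM journal l.23258.
-/

noncomputable section

namespace Summit.QuantumFields.BalabanUV.Beta.FP.PerfectPropagatorLegData

open Finset
open scoped BigOperators
open Literature.Probability.LatticeModels (latticeGreen)
open Literature.MathematicalPhysics.QuantumFieldTheory.Balaban1983to89.Beta
open Literature.MathematicalPhysics.QuantumFieldTheory.Balaban1983to89.Beta.TransverseStructure
open Literature.MathematicalPhysics.QuantumFieldTheory.Balaban1983to89.Beta.DyadicShell (Pt toReal supNorm supNorm_eq_zero_iff supNorm_pos norm_toReal)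
open Literature.MathematicalPhysics.QuantumFieldTheory.Balaban1983to89.Beta.BubbleTransfer (Leg c4 c4_pos unitVec invSq d1InvSq hessInvSq freeLeg freeLeg_a
  freeLeg_ℓ abs_grad_cont_le)
open Literature.MathematicalPhysics.QuantumFieldTheory.Balaban1983to89.Beta.TwoPowerLegs (TwoPower free free_g supNorm_sub_le_supNorm_add supNorm_unitVec)
open Summit.QuantumFields.BalabanUV.Beta.FP.PerfectPropagatorKernel (PinfKer KB CKB CB0 CB0_nonneg norm_KB_le_div_supNorm_cube re_PinfKer)
open Summit.QuantumFields.BalabanUV.Beta.FP.PerfectPropagatorKernelLegs (CKB_nonneg norm_KB_le_inv_succ_sq supNorm_cast_eq abs_re_PinfKer_le abs_re_PinfKer_fwdDiff_le)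
open Summit.QuantumFields.BalabanUV.Beta.FP.PerfectPropagatorKernelGraded (CKB₂ CKB₃ CKB₂_nonneg CKB₃_nonneg norm_KB_fwdDiff_le_inv_succ_pow_four
  norm_KB_fwdDiff₂_le_inv_succ_pow_five)
open Summit.QuantumFields.BalabanUV.Beta.FP.PerfectPropagatorLegDataFree (B3free B3free_nonneg free_diff2_le free_diff3_le free_diff1_sub_d1_le free_diff2_sub_hess_le)

/-! ## §1 The remainder `Re KB` at second and third order, `(‖z‖∞ + 1)` currency on `ℤ⁴` -/

/-- [folklore] `3 ≤ 3`, the dimension hypothesis of H2-P-KER at `d + 1 = 4`. -/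
theorem hd3 : (3 : ℕ) ≤ 3 := le_rfl

/-- [our object] **SECOND DIFFERENCES OF `Re KB`** (every `μ ν`, every `z ∈ ℤ⁴`): `≤ 32·(CKB₃ 3 + 4·CB0 3)∕(‖z‖∞+1)⁵` (V2b (K3) all-`z`). -/
theorem abs_re_KB_diff2_le (α β μ ν : Fin (3 + 1)) (z : Pt) :
    |(KB α β (z + Pi.single μ 1 + Pi.single ν 1)).re - (KB α β (z + Pi.single μ 1)).re - (KB α β (z + Pi.single ν 1)).re + (KB α β z).re|
      ≤ 32 * (CKB₃ 3 + 4 * CB0 3) / ((supNorm z : ℝ) + 1) ^ 5 := by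
  have h := norm_KB_fwdDiff₂_le_inv_succ_pow_five hd3 α β μ ν z
  rw [← supNorm_cast_eq] at h
  have e : (KB α β (z + Pi.single μ 1 + Pi.single ν 1)).re - (KB α β (z + Pi.single μ 1)).re - (KB α β (z + Pi.single ν 1)).re + (KB α β z).re
      = (KB α β (z + Pi.single μ 1 + Pi.single ν 1) - KB α β (z + Pi.single μ 1) - KB α β (z + Pi.single ν 1) + KB α β z).re := by
    simp only [Complex.sub_re, Complex.add_re]
  rw [e]
  exact (Complex.abs_re_le_norm _).trans h

/-- [folklore] the shift comparison `(‖z‖∞ + 1) ≤ 2·(‖z + e_κ‖∞ + 1)`, hence `K∕(‖z+e_κ‖∞+1)⁵ ≤ 32K∕(‖z‖∞+1)⁵` for `0 ≤ K`. -/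
theorem div_succ_pow_five_shift_le {K : ℝ} (hK : 0 ≤ K) (z : Pt) (κ : Fin 4) :
    K / ((supNorm (z + Pi.single κ 1) : ℝ) + 1) ^ 5 ≤ 32 * K / ((supNorm z : ℝ) + 1) ^ 5 := by
  have h1 : (supNorm z : ℝ) - 1 ≤ supNorm (z + Pi.single κ 1) := by
    have h := supNorm_sub_le_supNorm_add z (unitVec κ)
    rw [supNorm_unitVec] at h
    simpa [unitVec] using h
  have hs0 : (0 : ℝ) ≤ supNorm (z + Pi.single κ 1) := by positivity
  have ht0 : (0 : ℝ) ≤ supNorm z := by positivity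
  rw [div_le_div_iff₀ (by positivity) (by positivity)]
  have h2 : (supNorm z : ℝ) + 1 ≤ 2 * ((supNorm (z + Pi.single κ 1) : ℝ) + 1) := by linarith
  have h3 : ((supNorm z : ℝ) + 1) ^ 5 ≤ (2 * ((supNorm (z + Pi.single κ 1) : ℝ) + 1)) ^ 5 := pow_le_pow_left₀ (by positivity) h2 5
  nlinarith [h3, pow_nonneg hs0 5]

/-- [our object] **THIRD DIFFERENCES OF `Re KB`** (every `κ μ ν`, every `z`): `≤ 33·(32·(CKB₃ 3 + 4·CB0 3))∕(‖z‖∞+1)⁵` (two second differences, the shifted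
one compared through `div_succ_pow_five_shift_le`). -/
theorem abs_re_KB_diff3_le (α β κ μ ν : Fin (3 + 1)) (z : Pt) :
    |(KB α β (z + Pi.single κ 1 + Pi.single μ 1 + Pi.single ν 1)).re - (KB α β (z + Pi.single κ 1 + Pi.single μ 1)).re
        - (KB α β (z + Pi.single κ 1 + Pi.single ν 1)).re - (KB α β (z + Pi.single μ 1 + Pi.single ν 1)).re
        + (KB α β (z + Pi.single κ 1)).re + (KB α β (z + Pi.single μ 1)).re + (KB α β (z + Pi.single ν 1)).re - (KB α β z).re|
      ≤ 33 * (32 * (CKB₃ 3 + 4 * CB0 3)) / ((supNorm z : ℝ) + 1) ^ 5 := by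
  have hK : 0 ≤ 32 * (CKB₃ 3 + 4 * CB0 3) := by have := CKB₃_nonneg hd3; have := CB0_nonneg 3; positivity
  have h1 := (abs_re_KB_diff2_le α β μ ν (z + Pi.single κ 1)).trans (div_succ_pow_five_shift_le hK z κ)
  have h0 := abs_re_KB_diff2_le α β μ ν z
  have b1 := abs_le.mp h1; have b0 := abs_le.mp h0
  have e : (33 : ℝ) * (32 * (CKB₃ 3 + 4 * CB0 3)) / ((supNorm z : ℝ) + 1) ^ 5
      = 32 * (32 * (CKB₃ 3 + 4 * CB0 3)) / ((supNorm z : ℝ) + 1) ^ 5 + 32 * (CKB₃ 3 + 4 * CB0 3) / ((supNorm z : ℝ) + 1) ^ 5 := by ring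
  rw [e, abs_le]
  constructor <;> linarith [b1.1, b1.2, b0.1, b0.2]

/-! ## §2 The leg `legP := Re PinfKer` and its all-`z` letters -/

/-- [our object] THE LEG OF ROW H2-ASM-2: `legP α β z := Re PinfKer α β z`, the field block of the BF perfect propagator on `ℤ⁴` (one-point function;
H2V-0's two-point `Pker x z` is its translate). -/
def legP (α β : Fin (3 + 1)) (z : Pt) : ℝ := (PinfKer α β z).re

/-- [our object] (K0) for the leg: `legP α β z = [α=β]·latticeGreen z∕2 + Re KB α β z`. -/
theorem legP_eq (α β : Fin (3 + 1)) (z : Pt) : legP α β z = (if α = β then latticeGreen z / 2 else 0) + (KB α β z).re := by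
  unfold legP; exact re_PinfKer (by norm_num) α β z

/-- [our object] the value constant `A0P := 4(U₀ + c₄ + B₀) + 4(CKB 3 + CB0 3)`. -/
def A0P : ℝ := 4 * (free.U + c4 + free.B) + 4 * (CKB 3 + CB0 3)

/-- [our object] the first-difference constant `A1P`. -/
def A1P : ℝ := 8 * (2 * free.U + 2 * c4 + free.Bgrad) + 8 * (8 * (CKB 3 + CB0 3) + CKB 3)

/-- [our object] the second-difference constant `A2P`. -/
def A2P : ℝ := (2 ^ 4 * (64 * B3free + 89098 * c4) + ((4 : ℕ) + 1 : ℝ) ^ 4 * (4 * free.U)) + 32 * (CKB₃ 3 + 4 * CB0 3)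

/-- [our object] the third-difference constant `A3P`. -/
def A3P : ℝ := (2 ^ 5 * (128 * B3free + 701568 * c4) + ((6 : ℕ) + 1 : ℝ) ^ 5 * (8 * free.U)) + 33 * (32 * (CKB₃ 3 + 4 * CB0 3))

/-- [our object] **(L0) THE VALUE LETTER**: `|legP α β z| ≤ A0P∕(‖z‖∞+1)²` for every `z` ((D) `abs_re_PinfKer_le`). -/
theorem abs_legP_le (α β : Fin (3 + 1)) (z : Pt) : |legP α β z| ≤ A0P / ((supNorm z : ℝ) + 1) ^ 2 :=
  abs_re_PinfKer_le α β z

/-- [our object] **(L1) THE FIRST-DIFFERENCE LETTER**: `|legP (z + e_μ) − legP z| ≤ A1P∕(‖z‖∞+1)³` for every `z` ((D) `abs_re_PinfKer_fwdDiff_le`). -/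
theorem abs_legP_diff_le (α β μ : Fin (3 + 1)) (z : Pt) :
    |legP α β (z + Pi.single μ 1) - legP α β z| ≤ A1P / ((supNorm z : ℝ) + 1) ^ 3 :=
  abs_re_PinfKer_fwdDiff_le α β μ z

/-- [our object] **(L2) THE SECOND-DIFFERENCE LETTER** (every `μ ν`, every `z`): `|Δ_μΔ_ν legP z| ≤ A2P∕(‖z‖∞+1)⁴` — free part by PART 1b `free_diff2_le`, remainder by
§1 (exponent 5 ≥ 4). -/
theorem abs_legP_diff2_le (α β μ ν : Fin (3 + 1)) (z : Pt) :
    |legP α β (z + Pi.single μ 1 + Pi.single ν 1) - legP α β (z + Pi.single μ 1) - legP α β (z + Pi.single ν 1) + legP α β z|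
      ≤ A2P / ((supNorm z : ℝ) + 1) ^ 4 := by
  have hs1 : (1 : ℝ) ≤ (supNorm z : ℝ) + 1 := by linarith [show (0 : ℝ) ≤ supNorm z by positivity]
  have hKc : 0 ≤ 32 * (CKB₃ 3 + 4 * CB0 3) := by have := CKB₃_nonneg hd3; have := CB0_nonneg 3; positivity
  -- remainder part, exponent 5 weakened to 4
  have hK := (abs_re_KB_diff2_le α β μ ν z).trans
    (div_le_div_of_nonneg_left hKc (by positivity) (pow_le_pow_right₀ hs1 (by norm_num : 4 ≤ 5)))
  -- free part
  have hF : |(if α = β then latticeGreen (z + Pi.single μ 1 + Pi.single ν 1) / 2 else 0) - (if α = β then latticeGreen (z + Pi.single μ 1) / 2 else 0)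
        - (if α = β then latticeGreen (z + Pi.single ν 1) / 2 else 0) + (if α = β then latticeGreen z / 2 else 0)|
      ≤ (2 ^ 4 * (64 * B3free + 89098 * c4) + ((4 : ℕ) + 1 : ℝ) ^ 4 * (4 * free.U)) / ((supNorm z : ℝ) + 1) ^ 4 := by
    by_cases hab : α = β
    · simp only [if_pos hab]
      have h := free_diff2_le μ ν z
      simpa [unitVec] using h
    · simp only [if_neg hab, sub_zero, add_zero, abs_zero]
      have := B3free_nonneg; have := free.nonneg_U; have := c4_pos; positivity
  rw [legP_eq, legP_eq, legP_eq, legP_eq]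
  have bF := abs_le.mp hF; have bK := abs_le.mp hK
  unfold A2P
  rw [add_div, abs_le]
  constructor <;> linarith [bF.1, bF.2, bK.1, bK.2]

/-- [our object] **(L3) THE THIRD-DIFFERENCE LETTER** (every `κ μ ν`, every `z`): `|Δ_κΔ_μΔ_ν legP z| ≤ A3P∕(‖z‖∞+1)⁵` — free part by PART 1b `free_diff3_le`
(sharp Lawler differences + the vanishing third difference of the Taylor polynomial), remainder by §1. -/
theorem abs_legP_diff3_le (α β κ μ ν : Fin (3 + 1)) (z : Pt) :
    |legP α β (z + Pi.single κ 1 + Pi.single μ 1 + Pi.single ν 1) - legP α β (z + Pi.single κ 1 + Pi.single μ 1)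
        - legP α β (z + Pi.single κ 1 + Pi.single ν 1) - legP α β (z + Pi.single μ 1 + Pi.single ν 1)
        + legP α β (z + Pi.single κ 1) + legP α β (z + Pi.single μ 1) + legP α β (z + Pi.single ν 1) - legP α β z|
      ≤ A3P / ((supNorm z : ℝ) + 1) ^ 5 := by
  have hK := abs_re_KB_diff3_le α β κ μ ν z
  have hF : |(if α = β then latticeGreen (z + Pi.single κ 1 + Pi.single μ 1 + Pi.single ν 1) / 2 else 0)
        - (if α = β then latticeGreen (z + Pi.single κ 1 + Pi.single μ 1) / 2 else 0)
        - (if α = β then latticeGreen (z + Pi.single κ 1 + Pi.single ν 1) / 2 else 0)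
        - (if α = β then latticeGreen (z + Pi.single μ 1 + Pi.single ν 1) / 2 else 0)
        + (if α = β then latticeGreen (z + Pi.single κ 1) / 2 else 0) + (if α = β then latticeGreen (z + Pi.single μ 1) / 2 else 0)
        + (if α = β then latticeGreen (z + Pi.single ν 1) / 2 else 0) - (if α = β then latticeGreen z / 2 else 0)|
      ≤ (2 ^ 5 * (128 * B3free + 701568 * c4) + ((6 : ℕ) + 1 : ℝ) ^ 5 * (8 * free.U)) / ((supNorm z : ℝ) + 1) ^ 5 := by
    by_cases hab : α = β
    · simp only [if_pos hab]
      have h := free_diff3_le κ μ ν z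
      simpa [unitVec] using h
    · simp only [if_neg hab, sub_zero, add_zero, abs_zero]
      have := B3free_nonneg; have := free.nonneg_U; have := c4_pos; positivity
  simp only [legP_eq]
  have bF := abs_le.mp hF; have bK := abs_le.mp hK
  unfold A3P
  rw [add_div, abs_le]
  constructor <;> linarith [bF.1, bF.2, bK.1, bK.2]

/-! ## §3 The continuum dictionary -/

/-- [our object] `D0P := B₀ + CKB 3`. -/
def D0P : ℝ := free.B + CKB 3

/-- [our object] `D1P := (B3free + 112c₄) + 16(CKB₂ 3 + 2·CB0 3)`. -/
def D1P : ℝ := (B3free + 112 * c4) + 16 * (CKB₂ 3 + 2 * CB0 3)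

/-- [our object] `D2P := (64·B3free + 89088c₄) + 32(CKB₃ 3 + 4·CB0 3)`. -/
def D2P : ℝ := (64 * B3free + 89088 * c4) + 32 * (CKB₃ 3 + 4 * CB0 3)

/-- [our object] **(D0) THE VALUE DICTIONARY** (`z ≠ 0`): `|legP α β z − [α=β]·c₄·|X|⁻²| ≤ D0P∕‖z‖∞³` — HONESTLY only three powers: the remainder `KB` is
`O(‖z‖∞⁻³)` ((K1)), the free error `O(‖z‖∞⁻⁴)`. -/
theorem abs_legP_sub_invSq_le (α β : Fin (3 + 1)) {z : Pt} (hz : z ≠ 0) :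
    |legP α β z - (if α = β then c4 * invSq (toReal z) else 0)| ≤ D0P / (supNorm z : ℝ) ^ 3 := by
  have hs1 : (1 : ℝ) ≤ supNorm z := Leg.one_le_supNorm hz
  have hspos : (0 : ℝ) < supNorm z := by linarith
  have hB := free.nonneg_B
  have hK : |(KB α β z).re| ≤ CKB 3 / (supNorm z : ℝ) ^ 3 := by
    have h := norm_KB_le_div_supNorm_cube hd3 α β hz
    rw [← supNorm_cast_eq] at h
    exact (Complex.abs_re_le_norm _).trans h
  have hF : |(if α = β then latticeGreen z / 2 else 0) - (if α = β then c4 * invSq (toReal z) else 0)| ≤ free.B / (supNorm z : ℝ) ^ 3 := by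
    by_cases hab : α = β
    · simp only [if_pos hab]
      have h := free.err4 0 0 z hz
      rw [free_g] at h
      exact h.trans (div_le_div_of_nonneg_left hB (by positivity) (pow_le_pow_right₀ hs1 (by norm_num)))
    · simp only [if_neg hab, sub_zero, abs_zero]; positivity
  rw [legP_eq]
  have e : (if α = β then latticeGreen z / 2 else 0) + (KB α β z).re - (if α = β then c4 * invSq (toReal z) else 0)
      = ((if α = β then latticeGreen z / 2 else 0) - (if α = β then c4 * invSq (toReal z) else 0)) + (KB α β z).re := by ring
  rw [e]
  have bF := abs_le.mp hF; have bK := abs_le.mp hK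
  unfold D0P
  rw [add_div, abs_le]
  constructor <;> linarith [bF.1, bF.2, bK.1, bK.2]

/-- [our object] **(D1) THE FIRST-DIFFERENCE DICTIONARY** (`2 ≤ ‖z‖∞`): `|legP (z+e_i) − legP z − [α=β]·c₄·∂_i|X|⁻²| ≤ D1P∕‖z‖∞⁴` — free part by PART 1b
`free_diff1_sub_d1_le` (sharp Lawler + `taylor2_invSq`), remainder by V2b (K2) all-`z`. -/
theorem abs_legP_diff_sub_d1_le (α β i : Fin (3 + 1)) {z : Pt} (hz : 2 ≤ supNorm z) :
    |legP α β (z + Pi.single i 1) - legP α β z - (if α = β then c4 * d1InvSq i (toReal z) else 0)| ≤ D1P / (supNorm z : ℝ) ^ 4 := by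
  have hs2 : (2 : ℝ) ≤ supNorm z := by exact_mod_cast hz
  have hspos : (0 : ℝ) < supNorm z := by linarith
  have hKc : 0 ≤ 16 * (CKB₂ 3 + 2 * CB0 3) := by have := CKB₂_nonneg hd3; have := CB0_nonneg 3; positivity
  have hK : |(KB α β (z + Pi.single i 1)).re - (KB α β z).re| ≤ 16 * (CKB₂ 3 + 2 * CB0 3) / (supNorm z : ℝ) ^ 4 := by
    have h := norm_KB_fwdDiff_le_inv_succ_pow_four hd3 α β i z
    rw [← supNorm_cast_eq] at h
    rw [← Complex.sub_re]
    refine ((Complex.abs_re_le_norm _).trans h).trans ?_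
    exact div_le_div_of_nonneg_left hKc (by positivity) (pow_le_pow_left₀ hspos.le (by linarith) 4)
  have hF : |(if α = β then latticeGreen (z + Pi.single i 1) / 2 else 0) - (if α = β then latticeGreen z / 2 else 0)
        - (if α = β then c4 * d1InvSq i (toReal z) else 0)| ≤ (B3free + 112 * c4) / (supNorm z : ℝ) ^ 4 := by
    by_cases hab : α = β
    · simp only [if_pos hab]
      have h := free_diff1_sub_d1_le i hz
      simpa [unitVec] using h
    · simp only [if_neg hab, sub_zero, abs_zero]
      have := B3free_nonneg; have := c4_pos; positivity
  rw [legP_eq, legP_eq]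
  have e : (if α = β then latticeGreen (z + Pi.single i 1) / 2 else 0) + (KB α β (z + Pi.single i 1)).re
        - ((if α = β then latticeGreen z / 2 else 0) + (KB α β z).re) - (if α = β then c4 * d1InvSq i (toReal z) else 0)
      = ((if α = β then latticeGreen (z + Pi.single i 1) / 2 else 0) - (if α = β then latticeGreen z / 2 else 0)
          - (if α = β then c4 * d1InvSq i (toReal z) else 0)) + ((KB α β (z + Pi.single i 1)).re - (KB α β z).re) := by ring
  rw [e]
  have bF := abs_le.mp hF; have bK := abs_le.mp hK
  unfold D1P
  rw [add_div, abs_le]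
  constructor <;> linarith [bF.1, bF.2, bK.1, bK.2]

/-- [our object] **(D2) THE SECOND-DIFFERENCE DICTIONARY** (`4 ≤ ‖z‖∞`, every `μ ν`): `|Δ_μΔ_ν legP z − [α=β]·c₄·∂_μ∂_ν|X|⁻²| ≤ D2P∕‖z‖∞⁵` — free part by
PART 1b `free_diff2_sub_hess_le`, remainder by V2b (K3) all-`z`. -/
theorem abs_legP_diff2_sub_hess_le (α β μ ν : Fin (3 + 1)) {z : Pt} (hz : 4 ≤ supNorm z) :
    |legP α β (z + Pi.single μ 1 + Pi.single ν 1) - legP α β (z + Pi.single μ 1) - legP α β (z + Pi.single ν 1) + legP α β z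
        - (if α = β then c4 * hessInvSq μ ν (toReal z) else 0)| ≤ D2P / (supNorm z : ℝ) ^ 5 := by
  have hs4 : (4 : ℝ) ≤ supNorm z := by exact_mod_cast hz
  have hspos : (0 : ℝ) < supNorm z := by linarith
  have hKc : 0 ≤ 32 * (CKB₃ 3 + 4 * CB0 3) := by have := CKB₃_nonneg hd3; have := CB0_nonneg 3; positivity
  have hK := (abs_re_KB_diff2_le α β μ ν z).trans
    (div_le_div_of_nonneg_left hKc (by positivity) (pow_le_pow_left₀ hspos.le (by linarith) 5))
  have hF : |(if α = β then latticeGreen (z + Pi.single μ 1 + Pi.single ν 1) / 2 else 0) - (if α = β then latticeGreen (z + Pi.single μ 1) / 2 else 0)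
        - (if α = β then latticeGreen (z + Pi.single ν 1) / 2 else 0) + (if α = β then latticeGreen z / 2 else 0)
        - (if α = β then c4 * hessInvSq μ ν (toReal z) else 0)| ≤ (64 * B3free + 89088 * c4) / (supNorm z : ℝ) ^ 5 := by
    by_cases hab : α = β
    · simp only [if_pos hab]
      have h := free_diff2_sub_hess_le μ ν hz
      simpa [unitVec] using h
    · simp only [if_neg hab, sub_zero, add_zero, abs_zero]
      have := B3free_nonneg; have := c4_pos; positivity
  simp only [legP_eq]
  have bF := abs_le.mp hF; have bK := abs_le.mp hK
  unfold D2P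
  rw [add_div, abs_le]
  constructor <;> linarith [bF.1, bF.2, bK.1, bK.2]

end Summit.QuantumFields.BalabanUV.Beta.FP.PerfectPropagatorLegData

end
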